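import Summits.AtomisticToContinuum.BoseEinsteinCondensation.Theses.BECStronglyRayleigh
import Summits.AtomisticToContinuum.BoseEinsteinCondensation.Theorems.BECStronglyRayleighSectorGroundStatePerron
import Summits.AtomisticToContinuum.BoseEinsteinCondensation.Theorems.BECStronglyRayleighKineticLatticeBECLadderStep
import Summits.AtomisticToContinuum.BoseEinsteinCondensation.Theorems.BECStronglyRayleighKineticLatticeBECTransfer
import Literature.MathematicalPhysics.QuantumLattice.SectorEigenvalueContinuation
import HarnessLib

/-!
# Stub `stub_reduction` (line `Sketch`, crux `KineticLatticeBEC`, stmt-AtomisticToContinuum-9671):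
# the sector ladder — a uniformly positive insertion-fidelity budget gives lattice BEC

THE CONDITIONAL THEOREM OF THE LINE. Hard-core bosons on `(ℤ/Lℤ)³` (`xyTorus 3 L 1`, spin `½`, occupied =
up), `V = L³`, `Ŝ± = Ŝˣ_tot ± iŜʸ_tot`. Suppose `δ(L,N) ∈ [0,1]` bounds the insertion infidelity at every rung
`N → N+1` with `2(N+1) ≤ V`, `L ≥ L₁`: `(1 − δ(L,N))‖Ŝ⁺ψ₀‖²‖ψ₁‖² ≤ |⟨ψ₁, Ŝ⁺ψ₀⟩|²` for all nonzero
entrywise-nonnegative ground vectors `ψ₀`, `ψ₁` of the sectors `N − V/2`, `N + 1 − V/2`, and the budget is uniformly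
positive, `κ ≤ Π_{i<N}(1 − δ(L,i))` for `2N ≤ V`. Then `KineticLatticeBEC` (c = κ/2, L₀ = max L₁ 2).

Proof: the exact ladder. `‖Ŝ⁺φ‖² = ‖Ŝ⁻φ‖² + (V − 2n)‖φ‖²` on the sector `n − V/2` and Cauchy–Schwarz
(`stub_ladderStep`) turn the fidelity bound into `f(n+1) ≥ (1 − δ(L,n))(f(n) + V − 2n)` for
`f(n) = ‖Ŝ⁻φ_n‖²/‖φ_n‖²`; induction over `n ≤ N` (a sector-`n` Perron vector exists by
`SectorGroundStatePerron_proof`; the gain `V − 2n ≥ 0` is where the filling cap enters) gives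
`f(N) ≥ Π_{i<N}(1 − δ(L,i)) · N(V − N + 1) ≥ κ·N·V/2`, and `stub_transfer` identifies `f(N)` with the crux's
right-hand side. Sources: card `sector-ladder-coherent-insertion` (Cruxes/KineticLatticeBEC/Ideas); Tóth1991 for
the value `N(V − N + 1)`.
-/

noncomputable section

namespace Summit.AtomisticToContinuum.BoseEinsteinCondensation.Cruxes.KineticLatticeBEC.SectorLadder

open scoped BigOperators Matrix ComplexOrder
open Literature.MathematicalPhysics.QuantumLattice Literature.Probability.LatticeModels Matrix Complex
open Summit.AtomisticToContinuum.BoseEinsteinCondensation.Theses.BECStronglyRayleigh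

/-- **Stub E — the reduction (product form).** Let `δ(L,N) ∈ [0,1]` be insertion-infidelity bounds for the
rungs `N → N+1`, `2(N+1) ≤ L³`, `L ≥ L₁`, i.e. `(1 − δ(L,N))‖Ŝ⁺ψ₀‖²‖ψ₁‖² ≤ |⟨ψ₁, Ŝ⁺ψ₀⟩|²` for all nonzero
entrywise-nonnegative ground vectors `ψ₀`, `ψ₁` of the sectors `N − L³/2`, `N + 1 − L³/2` of `xyTorus 3 L 1`, whose
budget is uniformly positive: `κ ≤ Π_{i<N}(1 − δ(L,i))` for `2N ≤ L³`. Then `KineticLatticeBEC` holds (with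
`c = κ/2`, `L₀ = max L₁ 2`). Proof: by induction on `n ≤ N`, every nonnegative sector-`n` ground vector `φ` has
`Π_{i<n}(1 − δ(L,i)) · n(L³ − n + 1) · ‖φ‖² ≤ ‖Ŝ⁻φ‖²` (ladder step `stub_ladderStep` + the fidelity bound at each
rung, a sector-`n` Perron vector existing by `SectorGroundStatePerron_proof`, and the gain `L³ − 2n ≥ 0`); at
`n = N`, `N(L³ − N + 1) ≥ N·L³/2` gives the hypothesis of `stub_transfer`. [folklore] -/
theorem stub_reduction (κ : ℝ) (hκ : 0 < κ) (δ : ℕ → ℕ → ℝ) (L₁ : ℕ)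
    (hδ : ∀ L N : ℕ, L₁ ≤ L → 2 * (N + 1) ≤ L ^ 3 → 0 ≤ 1 - δ L N ∧ 1 - δ L N ≤ 1)
    (hprod : ∀ L N : ℕ, L₁ ≤ L → 2 * N ≤ L ^ 3 → κ ≤ ∏ i ∈ Finset.range N, (1 - δ L i))
    (hfid : ∀ (L : ℕ) [NeZero L], L₁ ≤ L → 2 ≤ L → ∀ N : ℕ, 2 * (N + 1) ≤ L ^ 3 →
      ∀ ψ₀ ψ₁ : TensorIndex (TorusSite 3 L) 2 → ℂ,
        ψ₀ ≠ 0 → (∀ σ, 0 ≤ (ψ₀ σ).re ∧ (ψ₀ σ).im = 0) →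
        ψ₀ ∈ spinZSector 1 ((N : ℝ) - (L : ℝ) ^ 3 / 2) →
        (xyTorus 3 L 1) *ᵥ ψ₀ =
          ((lowestEnergyInSector 1 (xyTorus 3 L 1) ((N : ℝ) - (L : ℝ) ^ 3 / 2) : ℝ) : ℂ) • ψ₀ →
        ψ₁ ≠ 0 → (∀ σ, 0 ≤ (ψ₁ σ).re ∧ (ψ₁ σ).im = 0) →
        ψ₁ ∈ spinZSector 1 (((N + 1 : ℕ) : ℝ) - (L : ℝ) ^ 3 / 2) →
        (xyTorus 3 L 1) *ᵥ ψ₁ =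
          ((lowestEnergyInSector 1 (xyTorus 3 L 1) (((N + 1 : ℕ) : ℝ) - (L : ℝ) ^ 3 / 2) : ℝ) : ℂ) •
            ψ₁ →
        (1 - δ L N) *
            (star ((totalSpin 1 0 + I • totalSpin 1 1 : Op (TorusSite 3 L) 2) *ᵥ ψ₀) ⬝ᵥ
              ((totalSpin 1 0 + I • totalSpin 1 1 : Op (TorusSite 3 L) 2) *ᵥ ψ₀)).re *
            (star ψ₁ ⬝ᵥ ψ₁).re ≤
          ‖star ψ₁ ⬝ᵥ ((totalSpin 1 0 + I • totalSpin 1 1 : Op (TorusSite 3 L) 2) *ᵥ ψ₀)‖ ^ 2) :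
    KineticLatticeBEC := by
  refine stub_transfer (κ / 2) (by positivity) L₁ ?_
  intro L _ hL₁L hL2 N hN1 h2N ψ hψ0 hψnn hψsec hHψ
  -- the fidelity budget `P n = Π_{i<n} (1 - δ(L,i))` lies in `[0, 1]`
  have hP0 : ∀ n ≤ N, 0 ≤ ∏ i ∈ Finset.range n, (1 - δ L i) := by
    intro n hn
    refine Finset.prod_nonneg fun i hi => (hδ L i hL₁L ?_).1
    rw [Finset.mem_range] at hi
    omega
  have hP1 : ∀ n ≤ N, ∏ i ∈ Finset.range n, (1 - δ L i) ≤ 1 := by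
    intro n hn
    refine Finset.prod_le_one (fun i hi => (hδ L i hL₁L ?_).1) (fun i hi => (hδ L i hL₁L ?_).2) <;>
    · rw [Finset.mem_range] at hi
      omega
  -- THE LADDER: induction over the sectors `0, 1, …, N`
  have claim : ∀ n : ℕ, n ≤ N → ∀ φ : TensorIndex (TorusSite 3 L) 2 → ℂ, φ ≠ 0 →
      (∀ σ, 0 ≤ (φ σ).re ∧ (φ σ).im = 0) → φ ∈ spinZSector 1 ((n : ℝ) - (L : ℝ) ^ 3 / 2) →
      (xyTorus 3 L 1) *ᵥ φ =
        ((lowestEnergyInSector 1 (xyTorus 3 L 1) ((n : ℝ) - (L : ℝ) ^ 3 / 2) : ℝ) : ℂ) • φ →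
      (∏ i ∈ Finset.range n, (1 - δ L i)) *
          ((n : ℝ) * ((L : ℝ) ^ 3 - n + 1)) * (star φ ⬝ᵥ φ).re ≤
        (star ((totalSpin 1 0 - I • totalSpin 1 1 : Op (TorusSite 3 L) 2) *ᵥ φ) ⬝ᵥ
          ((totalSpin 1 0 - I • totalSpin 1 1 : Op (TorusSite 3 L) 2) *ᵥ φ)).re := by
    intro n
    induction n with
    | zero =>
      intro _ φ _ _ _ _
      simp only [Nat.cast_zero, zero_mul, mul_zero]
      exact EigenvalueContinuation.re_star_dotProduct_self_nonneg _
    | succ n ih =>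
      intro hn1 φ₁ hφ₁0 hφ₁nn hφ₁sec hHφ₁
      -- a nonnegative ground vector of the sector `n` (Perron, support 9677)
      obtain ⟨φ₀, hφ₀0, hφ₀nn, hφ₀sec, hHφ₀, -⟩ :=
        Summit.AtomisticToContinuum.BoseEinsteinCondensation.Theorems.SectorGroundStatePerron_proof 3 L
          (by norm_num) hL2 n (by omega)
      have ih0 := ih (by omega) φ₀ hφ₀0 hφ₀nn hφ₀sec hHφ₀
      -- the ladder step at the rung `n → n+1`
      obtain ⟨hCS, hcomm⟩ :=
        stub_ladderStep (TorusSite 3 L) ((n : ℝ) - (L : ℝ) ^ 3 / 2) φ₀ φ₁ hφ₀sec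
      -- the fidelity bound at the rung `n → n+1`
      have h2n : 2 * (n + 1) ≤ L ^ 3 := le_trans (Nat.mul_le_mul_left 2 hn1) h2N
      have hA := hfid L hL₁L hL2 n h2n φ₀ φ₁ hφ₀0 hφ₀nn hφ₀sec hHφ₀ hφ₁0 hφ₁nn hφ₁sec hHφ₁
      have hfacn := hδ L n hL₁L h2n
      rw [Finset.prod_range_succ]
      -- name the real quantities
      set Pn : ℝ := ∏ i ∈ Finset.range n, (1 - δ L i) with hPn
      set d : ℝ := 1 - δ L n with hd
      set a : ℝ := (star φ₀ ⬝ᵥ φ₀).re with ha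
      set b : ℝ := (star φ₁ ⬝ᵥ φ₁).re with hb
      set F₀ : ℝ := (star ((totalSpin 1 0 - I • totalSpin 1 1 : Op (TorusSite 3 L) 2) *ᵥ φ₀) ⬝ᵥ
          ((totalSpin 1 0 - I • totalSpin 1 1 : Op (TorusSite 3 L) 2) *ᵥ φ₀)).re with hF₀
      set G₀ : ℝ := (star ((totalSpin 1 0 + I • totalSpin 1 1 : Op (TorusSite 3 L) 2) *ᵥ φ₀) ⬝ᵥ
          ((totalSpin 1 0 + I • totalSpin 1 1 : Op (TorusSite 3 L) 2) *ᵥ φ₀)).re with hG₀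
      set F₁ : ℝ := (star ((totalSpin 1 0 - I • totalSpin 1 1 : Op (TorusSite 3 L) 2) *ᵥ φ₁) ⬝ᵥ
          ((totalSpin 1 0 - I • totalSpin 1 1 : Op (TorusSite 3 L) 2) *ᵥ φ₁)).re with hF₁
      set X : ℝ := ‖star φ₁ ⬝ᵥ ((totalSpin 1 0 + I • totalSpin 1 1 : Op (TorusSite 3 L) 2) *ᵥ φ₀)‖ ^ 2
        with hX
      have ha0 : 0 < a := EigenvalueContinuation.re_star_dotProduct_self_pos hφ₀0
      have hb0 : 0 ≤ b := EigenvalueContinuation.re_star_dotProduct_self_nonneg _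
      have hPn1 : Pn ≤ 1 := hP1 n (by omega)
      have hV2n : 0 ≤ (L : ℝ) ^ 3 - 2 * n := by
        have : 2 * ((n : ℝ) + 1) ≤ (L : ℝ) ^ 3 := by exact_mod_cast h2n
        linarith
      -- d G₀ b ≤ X ≤ a F₁
      have hstep1 : d * G₀ * b ≤ a * F₁ := hA.trans hCS
      -- G₀ = F₀ + (V - 2n) a ≥ Pn (n+1)(V-n) a
      have hG₀eq : G₀ = F₀ + ((L : ℝ) ^ 3 - 2 * n) * a := by rw [hcomm]; ring
      have hG₀lb : Pn * (((n : ℝ) + 1) * ((L : ℝ) ^ 3 - n)) * a ≤ G₀ := by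
        have h1 : Pn * (((L : ℝ) ^ 3 - 2 * n) * a) ≤ 1 * (((L : ℝ) ^ 3 - 2 * n) * a) :=
          mul_le_mul_of_nonneg_right hPn1 (mul_nonneg hV2n ha0.le)
        have h2 : Pn * (((n : ℝ) + 1) * ((L : ℝ) ^ 3 - n)) * a =
            Pn * ((n : ℝ) * ((L : ℝ) ^ 3 - n + 1)) * a + Pn * (((L : ℝ) ^ 3 - 2 * n) * a) := by ring
        rw [hG₀eq, h2]
        linarith [ih0]
      have hstep2 : a * (Pn * d * (((n : ℝ) + 1) * ((L : ℝ) ^ 3 - n)) * b) ≤ a * F₁ := by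
        calc a * (Pn * d * (((n : ℝ) + 1) * ((L : ℝ) ^ 3 - n)) * b)
              = d * (Pn * (((n : ℝ) + 1) * ((L : ℝ) ^ 3 - n)) * a) * b := by ring
          _ ≤ d * G₀ * b := mul_le_mul_of_nonneg_right (mul_le_mul_of_nonneg_left hG₀lb hfacn.1) hb0
          _ ≤ a * F₁ := hstep1
      have hfin := le_of_mul_le_mul_left hstep2 ha0
      push_cast
      calc Pn * d * (((n : ℝ) + 1) * ((L : ℝ) ^ 3 - ((n : ℝ) + 1) + 1)) * b
            = Pn * d * (((n : ℝ) + 1) * ((L : ℝ) ^ 3 - n)) * b := by ring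
        _ ≤ F₁ := hfin
  -- the rung `N` for the given `ψ`
  have hN := claim N le_rfl ψ hψ0 hψnn hψsec hHψ
  have ha0 : 0 ≤ (star ψ ⬝ᵥ ψ).re := EigenvalueContinuation.re_star_dotProduct_self_nonneg _
  have hPN0 := hP0 N le_rfl
  have hT : (N : ℝ) * (L : ℝ) ^ 3 / 2 ≤ (N : ℝ) * ((L : ℝ) ^ 3 - N + 1) := by
    have hN0 : (0 : ℝ) ≤ N := Nat.cast_nonneg N
    have h2N' : 2 * (N : ℝ) ≤ (L : ℝ) ^ 3 := by exact_mod_cast h2N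
    nlinarith
  calc κ / 2 * N * (L : ℝ) ^ 3 * (star ψ ⬝ᵥ ψ).re
        = κ * ((N : ℝ) * (L : ℝ) ^ 3 / 2) * (star ψ ⬝ᵥ ψ).re := by ring
    _ ≤ (∏ i ∈ Finset.range N, (1 - δ L i)) * ((N : ℝ) * ((L : ℝ) ^ 3 - N + 1)) *
          (star ψ ⬝ᵥ ψ).re := by
        apply mul_le_mul_of_nonneg_right _ ha0
        exact mul_le_mul (hprod L N hL₁L h2N) hT (by positivity) hPN0
    _ ≤ _ := hN

end Summit.AtomisticToContinuum.BoseEinsteinCondensation.Cruxes.KineticLatticeBEC.SectorLadder
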